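/-
Copyright: the b2b-balaban T⁴-continuum CRUX team, row NE7b OWNER lineage `t4-ne7b-p1` (gen 118). Project licence.
-/
import Summits.QuantumFields.BalabanUV.T4Continuum.Spine.NE7b.SupTorusFibreResponse

/-!
# THE GLOBAL BACKGROUND MAP IS DIFFERENTIABLE AT EVERY BLOCK FIELD, ITS DERIVATIVE IS THE FIBRE RESPONSE: in the convex regime
# `u′ ≥ −λ`, `λ < min(2,a)` the background map `Φ` of (93) (block means `Q′t(Φ w) = w`, sitewise equation at every `w`) is
# CONTINUOUS and has, AT EVERY coarse torus field `wt`, the derivative `Dt(wt)` = the unique section of the block mean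
# (`Q′t(Dt k) = k`) whose linearised covector `⟨(At + u′(Φ wt))·Dt k, –⟩` kills the fibre ((98)'s fluctuation solve) — an
# implicit-function theorem proved from strong convexity alone: no chart radius, no small-field window, no two-sided curvature
# letter, no continuity of `u′`
# (row NE7b, node U5c; (92) + (93) + (100) + TEA + INST BY NAME; [folklore])

Cell `pub-balaban`, sub-cell `t4`, spine estimate NE7b (`T4WeightBudget.RelWeightBound`; the cell's OWN estimate — NOT PRINTED in
[Bałaban 1983–89], NOT PROVED).  Crux-route work under `Spine/NE7b/` by the row OWNER (`t4-ne7b-p1` gen 118) under FREEZE (0)'s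
crux-prover clause, on gen 117's located item (a) «C¹ of the GLOBAL background map in the convex regime»; NOTHING of Bałaban's is
named as a Lean object, valued or asserted; no `T4Continuum/Support` leaf typed; no `def`, no notation (background maps and
responses are quantified, not constructed); zero `sorry`.  Imports (BY NAME): the OWNER's (100) `…SupTorusFibreResponse`
(`exists_fibre_response`; through it (96) `exists_clm_blockLift`, (92) `action_firstOrder_lower` ∕ `isMinOn_fibre_of_critical`, (93)
`norm_sq_le_sum_sq` ∕ `existsUnique_torus_background`, (89) `torus_form_coercive`, (90) `response_form_floor`, TEA `exists_clm_pair` ∕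
`exists_clm_pairForm` ∕ `hasFDerivAt_action` ∕ `differentiableAt_action` ∕ `hasFDerivAt_fderiv_action`, INST
`fderiv_action_torus_eq_zero`, TDF `torus_operator_form_symm`, (86) `hasDerivAt_phiFour`).

WHY (located).  The sup road differentiates the background through its `ℓ^∞` chart (ASE ∕ (60) ∕ (75)), hence on a small ball and
under two-sided Lipschitz letters for `u′`; (96) made the effective action `C¹` globally WITHOUT differentiating `Φ`.  For the
Hessian of the effective action at an ARBITRARY block field (HESS ∕ (90) want `HasFDerivAt σt Dt` along a branch) the background
itself must be differentiated everywhere.  Strong convexity does it by hand.  CONTINUITY: minimality of `Φ w′` on the fibre of `w′`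
against the shifted background `Φ w + M(w′ − w)` and the first-order letter at `Φ w` (whose linear term sees only `M(w′ − w)`,
the rest of `Φ w′ − Φ w` lying in `ker Q′t`) give `½(γ − λ)·Σ(Φ w′ − Φ w)² ≤ S(Φ w + M(w′ − w)) − S(Φ w) − DS(Φ w)(M(w′ − w)) → 0`.
DERIVATIVE: put `y = Φ(w + k) − Φ w`, `r = y − Dt k ∈ ker Q′t`.  Fibre-criticality at both backgrounds kills
`DS(Φ(w + k)) − DS(Φ w)` on `r`, the response letter kills `S″(Φ w)(Dt k, r)`, so `S″(Φ w)(r, r) = −ρ(r)` with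
`ρ = DS(Φ w + y) − DS(Φ w) − S″(Φ w) y`, `‖ρ‖ ≤ ε′‖y‖` once `y` is small (TEA: `DS` is differentiable at `Φ w`; `y → 0` by
continuity).  The floor `(γ − λ)·Σ r² ≤ S″(Φ w)(r, r)` gives `(γ − λ)‖r‖ ≤ ε′‖y‖`, then `‖y‖ ≤ ‖Dt‖‖k‖ + ‖r‖` bootstraps to
`‖y‖ ≤ 2‖Dt‖‖k‖` and `‖r‖ = o(‖k‖)`.  The response `Dt` exists as a continuous linear map by (100).

WHAT IS PROVED ([folklore]):
* §1 (TEA's level: finite carriers `ι`, `κ`; symmetric `At` with a form floor `γ`; `v′ = u`, `u′` a derivative of `u`, `u′ ≥ −λ`,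
  `λ < γ`; ANY `Qt` with a continuous linear right inverse `M`; `Φ` ANY map with `Qt(Φ w) = w` and `DS(Φ w)` killing `ker Qt`)
  **`continuousAt_fibreCritical`** (`Φ` is continuous at every `w`), **`hasFDerivAt_fibreCritical`** (ANY `D` with the two response
  letters at `Φ w` — `Qt(D k) = k`, `S″(Φ w)(D k, κ) = 0` on `ker Qt` — IS the derivative: `HasFDerivAt Φ D w`),
  **`exists_hasFDerivAt_fibreCritical`** (assembled with (100): `∃ D` with the two letters and `HasFDerivAt Φ D w`).
* §2 (the `Beta.Site` carriers, displayed actions; `u′ ≥ −λ` on `ℝ`, `λ < min(2,a)`) **`torus_background_continuous`** (ANY background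
  map is continuous), `torus_background_hasFDerivAt_of_letters` (any `Dt` with the two torus letters is the derivative), THE END
  **`torus_background_hasFDerivAt`** (ANY background map `Φ`, EVERY `wt`: `∃ Dt`, `Q′t(Dt k) = k`, the linearised sitewise letter on
  the fibre, `HasFDerivAt Φ Dt wt`).
* §3 **`phiFour_background_hasFDerivAt`** (`u t = g t³ + m t`, `0 ≤ g`, `−m < min(2,a)`).

HONEST (what this is NOT).  Finite-dimensional calculus + (92)∕(93)∕(100) by name; differentiability at every point, NOT a
modulus for `w ↦ Dt(w)` (continuity of the response in `w` needs continuity of `u′`; `C²` of `Φ` needs `u″`); the operator norm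
`‖Dt‖` is whatever it is (no mesh-∕volume-free bound is claimed here — (98) bounds the fibre correction in `ℓ²` by
`(min(2,a) − λ)⁻¹`); one-sided curvature only, so none of the sup road's locality letters follow; nothing about the measure; cubic
periods; scalar skeleton, hard constraint, not the covariant operators ((A3), NC-NE7b-α UNRULED); nothing of Bałaban's.  BY-NAME
EFFECT ON THE WALL: NONE.  NE7b NOT PRINTED ∕ NOT PROVED; spine PROVED 0∕9; rung (B)+1 on a FINITE torus — NOT infinite volume, NOT
the mass gap, NOT Clay.  HONEST DEPENDENCY: continuum YM on T⁴ ⇐ BetaPertH ∧ nine spine estimates (0∕9 proved); BetaPertH ⇐ (D1) ∧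
(D4) ∧ CAP+tail; G-an2-4 gates asym, D1 and NE2∕3∕4.
-/

set_option autoImplicit false

noncomputable section

namespace Summit.QuantumFields.BalabanUV.T4Continuum.NE7b.SupTorusBackgroundDerivative

open Set Function Filter Asymptotics Metric
open scoped ENNReal Topology
open Literature.MathematicalPhysics.QuantumFieldTheory.Balaban1983to89
open B6QGQLower276 (X blk B side AX)
open B5Hk103ScalarZd (nbhd)
open Beta (Site siteOf windowMap)
open SupTorusDirichletForm (torus_operator_form_symm)
open SupTorusDirichletFormCoercive (torus_form_coercive)
open SupTorusEffectiveAction (exists_clm_pair exists_clm_pairForm hasFDerivAt_action differentiableAt_action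
  hasFDerivAt_fderiv_action)
open SupTorusEffectiveActionInstance (fderiv_action_torus_eq_zero)
open SupTorusActionConvex (action_firstOrder_lower isMinOn_fibre_of_critical)
open SupTorusActionMinimiser (norm_sq_le_sum_sq existsUnique_torus_background hasDerivAt_phiFour_potential)
open SupTorusEffectiveActionHessianFloor (response_form_floor)
open SupTorusEffectiveActionGradient (exists_clm_blockLift)
open SupTorusFibreResponse (exists_fibre_response)
open SupPhiFourBackground (hasDerivAt_phiFour)

variable {d : ℕ}

/-! ## §1. TEA's level: the response exists, the fibre-critical map is continuous and differentiable -/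

section Generic

variable {ι κ : Type*} [Fintype ι] [Fintype κ]

omit [Fintype κ] in
/-- **A FIBRE-CRITICAL MAP IS CONTINUOUS** (symmetric `At` with a form floor `γ`, `v′ = u`, `u′ ≥ −λ`, `λ < γ`; `Qt` with a right
inverse `M`; `Φ` ANY map with `Qt(Φ w) = w` whose values are fibre-critical): `ContinuousAt Φ w` at EVERY `w` — from
`½(γ − λ)·Σ(Φ w′ − Φ w)² ≤ S(Φ w + M(w′ − w)) − S(Φ w) − DS(Φ w)(M(w′ − w))`. [folklore] -/
theorem continuousAt_fibreCritical (At : (ι → ℝ) →L[ℝ] (ι → ℝ))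
    (hAt : ∀ φ ψ : ι → ℝ, ∑ x, ψ x * At φ x = ∑ x, φ x * At ψ x) {γ : ℝ}
    (hγ : ∀ h : ι → ℝ, γ * ∑ x, h x ^ 2 ≤ ∑ x, h x * At h x) {v u u' : ℝ → ℝ} (hv : ∀ t, HasDerivAt v (u t) t)
    (hu : ∀ t, HasDerivAt u (u' t) t) {lam : ℝ} (hu' : ∀ t, -lam ≤ u' t) (hγlam : lam < γ)
    (Qt : (ι → ℝ) →L[ℝ] (κ → ℝ)) (M : (κ → ℝ) →L[ℝ] (ι → ℝ)) (hM : ∀ k : κ → ℝ, Qt (M k) = k)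
    (Φ : (κ → ℝ) → (ι → ℝ)) (hΦQ : ∀ w, Qt (Φ w) = w)
    (hΦcrit : ∀ (w : κ → ℝ) (h : ι → ℝ), Qt h = 0 →
      fderiv ℝ (fun φ : ι → ℝ => (1 / 2 : ℝ) * ∑ x, φ x * At φ x + ∑ x, v (φ x)) (Φ w) h = 0)
    (w : κ → ℝ) : ContinuousAt Φ w := by
  obtain ⟨L, hL⟩ := exists_clm_pair (fun x => At (Φ w) x + u (Φ w x))
  have hS : HasFDerivAt (fun φ : ι → ℝ => (1 / 2 : ℝ) * ∑ x, φ x * At φ x + ∑ x, v (φ x)) L (Φ w) :=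
    hasFDerivAt_action At hAt hv (Φ w) hL
  have hDf : fderiv ℝ (fun φ : ι → ℝ => (1 / 2 : ℝ) * ∑ x, φ x * At φ x + ∑ x, v (φ x)) (Φ w) = L := hS.fderiv
  have hm : 0 < γ - lam := sub_pos.2 hγlam
  -- the gap function along the shifted background
  have hScont : Continuous (fun φ : ι → ℝ => (1 / 2 : ℝ) * ∑ x, φ x * At φ x + ∑ x, v (φ x)) :=
    (show Differentiable ℝ (fun φ : ι → ℝ => (1 / 2 : ℝ) * ∑ x, φ x * At φ x + ∑ x, v (φ x)) from
      fun φ => differentiableAt_action At hAt hv φ).continuous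
  have hRcont : Continuous (fun w' : κ → ℝ =>
      ((1 / 2 : ℝ) * ∑ x, (Φ w + M (w' - w)) x * At (Φ w + M (w' - w)) x + ∑ x, v ((Φ w + M (w' - w)) x))
        - ((1 / 2 : ℝ) * ∑ x, Φ w x * At (Φ w) x + ∑ x, v (Φ w x)) - L (M (w' - w))) := by
    have hshift : Continuous (fun w' : κ → ℝ => Φ w + M (w' - w)) :=
      continuous_const.add (M.continuous.comp (continuous_id.sub continuous_const))
    exact ((hScont.comp hshift).sub continuous_const).sub (L.continuous.comp (M.continuous.comp
      (continuous_id.sub continuous_const)))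
  -- the key inequality
  have hkey : ∀ w' : κ → ℝ, (γ - lam) / 2 * ∑ x, (Φ w' x - Φ w x) ^ 2
      ≤ ((1 / 2 : ℝ) * ∑ x, (Φ w + M (w' - w)) x * At (Φ w + M (w' - w)) x + ∑ x, v ((Φ w + M (w' - w)) x))
        - ((1 / 2 : ℝ) * ∑ x, Φ w x * At (Φ w) x + ∑ x, v (Φ w x)) - L (M (w' - w)) := by
    intro w'
    -- minimality of `Φ w′` on its fibre against the shifted background
    have hmin := isMinOn_fibre_of_critical At hAt hγ hv hu hu' hγlam.le Qt (hΦcrit w')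
    have hup : (1 / 2 : ℝ) * ∑ x, Φ w' x * At (Φ w') x + ∑ x, v (Φ w' x)
        ≤ (1 / 2 : ℝ) * ∑ x, (Φ w + M (w' - w)) x * At (Φ w + M (w' - w)) x + ∑ x, v ((Φ w + M (w' - w)) x) := by
      refine isMinOn_iff.1 hmin (Φ w + M (w' - w)) ?_
      show Qt (Φ w + M (w' - w)) = Qt (Φ w')
      rw [map_add Qt, hM, hΦQ, hΦQ]; abel
    -- the first-order letter at `Φ w`, linear term on `M(w′ − w)` only
    have h1 := action_firstOrder_lower At hAt hγ hv hu hu' (Φ w) (Φ w')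
    rw [hDf] at h1
    have hker : Qt (Φ w' - Φ w - M (w' - w)) = 0 := by
      rw [map_sub Qt, map_sub Qt, hΦQ, hΦQ, hM]; abel
    have hkill := hΦcrit w (Φ w' - Φ w - M (w' - w)) hker
    rw [hDf, map_sub] at hkill
    rw [sub_eq_zero.1 hkill] at h1
    linarith
  -- squeeze `‖Φ w′ − Φ w‖ ≤ √((2∕(γ−λ))·R w′) → 0`
  rw [ContinuousAt, tendsto_iff_norm_sub_tendsto_zero]
  refine squeeze_zero (fun w' => norm_nonneg _) (fun w' => ?_)
    (g := fun w' : κ → ℝ => Real.sqrt (2 / (γ - lam) *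
      (((1 / 2 : ℝ) * ∑ x, (Φ w + M (w' - w)) x * At (Φ w + M (w' - w)) x + ∑ x, v ((Φ w + M (w' - w)) x))
        - ((1 / 2 : ℝ) * ∑ x, Φ w x * At (Φ w) x + ∑ x, v (Φ w x)) - L (M (w' - w))))) ?_
  · rw [← abs_of_nonneg (norm_nonneg (Φ w' - Φ w))]
    refine Real.abs_le_sqrt ?_
    have h1 : ‖Φ w' - Φ w‖ ^ 2 ≤ ∑ x, (Φ w' x - Φ w x) ^ 2 := by
      simpa only [Pi.sub_apply] using norm_sq_le_sum_sq (Φ w' - Φ w)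
    have h2 := hkey w'
    have h3 : ∑ x, (Φ w' x - Φ w x) ^ 2 ≤ 2 / (γ - lam) *
        (((1 / 2 : ℝ) * ∑ x, (Φ w + M (w' - w)) x * At (Φ w + M (w' - w)) x + ∑ x, v ((Φ w + M (w' - w)) x))
          - ((1 / 2 : ℝ) * ∑ x, Φ w x * At (Φ w) x + ∑ x, v (Φ w x)) - L (M (w' - w))) := by
      have hne : γ - lam ≠ 0 := ne_of_gt hm
      have hpos : (0 : ℝ) < 2 / (γ - lam) := by positivity
      calc ∑ x, (Φ w' x - Φ w x) ^ 2 = 2 / (γ - lam) * ((γ - lam) / 2 * ∑ x, (Φ w' x - Φ w x) ^ 2) := by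
            field_simp
        _ ≤ _ := mul_le_mul_of_nonneg_left h2 hpos.le
    exact h1.trans h3
  · have h0 : Real.sqrt (2 / (γ - lam) *
        (((1 / 2 : ℝ) * ∑ x, (Φ w + M (w - w)) x * At (Φ w + M (w - w)) x + ∑ x, v ((Φ w + M (w - w)) x))
          - ((1 / 2 : ℝ) * ∑ x, Φ w x * At (Φ w) x + ∑ x, v (Φ w x)) - L (M (w - w)))) = 0 := by
      simp only [sub_self, map_zero, add_zero, Real.sqrt_eq_zero', mul_zero, le_refl]
    rw [← h0]
    exact ((Real.continuous_sqrt.comp (continuous_const.mul hRcont)).tendsto w)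

/-- **ANY RESPONSE WITH THE TWO LETTERS IS THE DERIVATIVE OF THE FIBRE-CRITICAL MAP** (same regime): if `Qt (D k) = k` and the
linearised covector at `Φ w` on `D k` kills `ker Qt` (`Σ_x ((At(D k)) x + u′(Φ w x)·(D k) x)·κ x = 0`), then `HasFDerivAt Φ D w` —
`(γ − λ)‖r‖ ≤ ε′‖y‖`, `‖y‖ ≤ 2‖D‖‖k‖` for `y = Φ(w+k) − Φ w`, `r = y − D k`. [folklore] -/
theorem hasFDerivAt_fibreCritical (At : (ι → ℝ) →L[ℝ] (ι → ℝ))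
    (hAt : ∀ φ ψ : ι → ℝ, ∑ x, ψ x * At φ x = ∑ x, φ x * At ψ x) {γ : ℝ}
    (hγ : ∀ h : ι → ℝ, γ * ∑ x, h x ^ 2 ≤ ∑ x, h x * At h x) {v u u' : ℝ → ℝ} (hv : ∀ t, HasDerivAt v (u t) t)
    (hu : ∀ t, HasDerivAt u (u' t) t) {lam : ℝ} (hu' : ∀ t, -lam ≤ u' t) (hγlam : lam < γ)
    (Qt : (ι → ℝ) →L[ℝ] (κ → ℝ)) (M : (κ → ℝ) →L[ℝ] (ι → ℝ)) (hM : ∀ k : κ → ℝ, Qt (M k) = k)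
    (Φ : (κ → ℝ) → (ι → ℝ)) (hΦQ : ∀ w, Qt (Φ w) = w)
    (hΦcrit : ∀ (w : κ → ℝ) (h : ι → ℝ), Qt h = 0 →
      fderiv ℝ (fun φ : ι → ℝ => (1 / 2 : ℝ) * ∑ x, φ x * At φ x + ∑ x, v (φ x)) (Φ w) h = 0)
    (w : κ → ℝ) {D : (κ → ℝ) →L[ℝ] (ι → ℝ)} (hDQ : ∀ k : κ → ℝ, Qt (D k) = k)
    (hDlin : ∀ (k : κ → ℝ) (κ' : ι → ℝ), Qt κ' = 0 → ∑ x, (At (D k) x + u' (Φ w x) * D k x) * κ' x = 0) :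
    HasFDerivAt Φ D w := by
  obtain ⟨H, hH⟩ := exists_clm_pairForm At (fun x => u' (Φ w x))
  have hS2 : HasFDerivAt (fderiv ℝ (fun φ : ι → ℝ => (1 / 2 : ℝ) * ∑ x, φ x * At φ x + ∑ x, v (φ x))) H (Φ w) :=
    hasFDerivAt_fderiv_action At hAt hv hu (Φ w) hH
  have hcont : ContinuousAt Φ w :=
    continuousAt_fibreCritical At hAt hγ hv hu hu' hγlam Qt M hM Φ hΦQ hΦcrit w
  have hm : 0 < γ - lam := sub_pos.2 hγlam
  have hfl : ∀ h : ι → ℝ, (γ - lam) * ∑ x, h x ^ 2 ≤ H h h := fun h => by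
    rw [hH]; exact response_form_floor At hγ (fun x => hu' (Φ w x)) h
  rw [hasFDerivAt_iff_isLittleO_nhds_zero, Asymptotics.isLittleO_iff]
  intro ε hε
  -- the auxiliary tolerance
  obtain ⟨ε', hε'0, hε'1, hε'2⟩ : ∃ ε' : ℝ, 0 < ε' ∧ ε' ≤ (γ - lam) / 2 ∧ ε' * (2 * ‖D‖) ≤ ε * (γ - lam) := by
    refine ⟨min ((γ - lam) / 2) (ε * (γ - lam) / (2 * ‖D‖ + 1)), lt_min (by positivity) (by positivity), min_le_left _ _, ?_⟩
    have h2D : (0 : ℝ) ≤ 2 * ‖D‖ := by positivity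
    calc min ((γ - lam) / 2) (ε * (γ - lam) / (2 * ‖D‖ + 1)) * (2 * ‖D‖)
        ≤ ε * (γ - lam) / (2 * ‖D‖ + 1) * (2 * ‖D‖) := mul_le_mul_of_nonneg_right (min_le_right _ _) h2D
      _ ≤ ε * (γ - lam) / (2 * ‖D‖ + 1) * (2 * ‖D‖ + 1) :=
          mul_le_mul_of_nonneg_left (by linarith) (by positivity)
      _ = ε * (γ - lam) := div_mul_cancel₀ _ (by positivity)
  -- `DS` is differentiable at `Φ w`: the remainder is `≤ ε′‖y‖` for small `y`, and `y = Φ(w+k) − Φ w → 0`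
  have h2 := (hasFDerivAt_iff_isLittleO_nhds_zero.1 hS2)
  rw [Asymptotics.isLittleO_iff] at h2
  have htend : Tendsto (fun k : κ → ℝ => Φ (w + k) - Φ w) (𝓝 0) (𝓝 0) := by
    have h1 : Tendsto (fun k : κ → ℝ => w + k) (𝓝 0) (𝓝 w) :=
      ((continuous_const (y := w)).add continuous_id).tendsto' 0 w (by simp)
    have h3 : Tendsto (fun k : κ → ℝ => Φ (w + k)) (𝓝 0) (𝓝 (Φ w)) := hcont.tendsto.comp h1
    simpa only [sub_self] using h3.sub (tendsto_const_nhds (x := Φ w))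
  refine (htend.eventually (h2 hε'0)).mono fun k hk => ?_
  -- the algebra at a fixed `k`
  have hwy : Φ w + (Φ (w + k) - Φ w) = Φ (w + k) := by abel
  rw [hwy] at hk
  set y : ι → ℝ := Φ (w + k) - Φ w with hy
  set r : ι → ℝ := y - D k with hr
  have hQr : Qt r = 0 := by
    rw [hr, hy, map_sub Qt, map_sub Qt, hΦQ, hΦQ, hDQ]; abel
  -- `H r r = −ρ r`
  have hHr : H r r = -((fderiv ℝ (fun φ : ι → ℝ => (1 / 2 : ℝ) * ∑ x, φ x * At φ x + ∑ x, v (φ x)) (Φ (w + k))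
      - fderiv ℝ (fun φ : ι → ℝ => (1 / 2 : ℝ) * ∑ x, φ x * At φ x + ∑ x, v (φ x)) (Φ w) - H y) r) := by
    rw [sub_apply, sub_apply, hΦcrit (w + k) r hQr, hΦcrit w r hQr]
    have hHD : H (D k) r = 0 := by rw [hH]; exact hDlin k r hQr
    have hH1 : H r = H y - H (D k) := by rw [hr, map_sub]
    have : H r r = H y r - H (D k) r := by rw [hH1, sub_apply]
    rw [this, hHD]; ring
  -- `(γ − λ)‖r‖² ≤ ε′‖y‖‖r‖`
  have h3 : (γ - lam) * ‖r‖ ^ 2 ≤ ε' * ‖y‖ * ‖r‖ := by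
    calc (γ - lam) * ‖r‖ ^ 2 ≤ (γ - lam) * ∑ x, r x ^ 2 := mul_le_mul_of_nonneg_left (norm_sq_le_sum_sq r) hm.le
      _ ≤ H r r := hfl r
      _ = _ := hHr
      _ ≤ ‖(fderiv ℝ (fun φ : ι → ℝ => (1 / 2 : ℝ) * ∑ x, φ x * At φ x + ∑ x, v (φ x)) (Φ (w + k))
            - fderiv ℝ (fun φ : ι → ℝ => (1 / 2 : ℝ) * ∑ x, φ x * At φ x + ∑ x, v (φ x)) (Φ w) - H y) r‖ := by
          rw [Real.norm_eq_abs]; exact neg_le_abs _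
      _ ≤ ‖fderiv ℝ (fun φ : ι → ℝ => (1 / 2 : ℝ) * ∑ x, φ x * At φ x + ∑ x, v (φ x)) (Φ (w + k))
            - fderiv ℝ (fun φ : ι → ℝ => (1 / 2 : ℝ) * ∑ x, φ x * At φ x + ∑ x, v (φ x)) (Φ w) - H y‖ * ‖r‖ :=
          ContinuousLinearMap.le_opNorm _ r
      _ ≤ ε' * ‖y‖ * ‖r‖ := mul_le_mul_of_nonneg_right hk (norm_nonneg _)
  have h4 : (γ - lam) * ‖r‖ ≤ ε' * ‖y‖ := by
    by_cases h0 : ‖r‖ = 0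
    · rw [h0, mul_zero]; positivity
    · have hpos : 0 < ‖r‖ := (norm_nonneg _).lt_of_ne (Ne.symm h0)
      have : (γ - lam) * ‖r‖ * ‖r‖ ≤ ε' * ‖y‖ * ‖r‖ := by rw [mul_assoc, ← sq]; exact h3
      exact le_of_mul_le_mul_right this hpos
  -- bootstrap `‖y‖ ≤ 2‖D‖‖k‖`
  have h5 : ‖y‖ ≤ 2 * ‖D‖ * ‖k‖ := by
    have hy' : y = D k + r := by rw [hr]; abel
    have h6 : ‖y‖ ≤ ‖D‖ * ‖k‖ + ‖r‖ := by
      rw [hy']; exact (norm_add_le _ _).trans (add_le_add (D.le_opNorm k) le_rfl)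
    have h7 : (γ - lam) * ‖r‖ ≤ (γ - lam) / 2 * ‖y‖ := h4.trans (mul_le_mul_of_nonneg_right hε'1 (norm_nonneg _))
    nlinarith [norm_nonneg r, norm_nonneg y, norm_nonneg k, norm_nonneg D]
  -- conclude
  show ‖Φ (w + k) - Φ w - D k‖ ≤ ε * ‖k‖
  have h8 : (γ - lam) * ‖r‖ ≤ (γ - lam) * (ε * ‖k‖) := by
    calc (γ - lam) * ‖r‖ ≤ ε' * ‖y‖ := h4
      _ ≤ ε' * (2 * ‖D‖ * ‖k‖) := mul_le_mul_of_nonneg_left h5 hε'0.le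
      _ = ε' * (2 * ‖D‖) * ‖k‖ := by ring
      _ ≤ ε * (γ - lam) * ‖k‖ := mul_le_mul_of_nonneg_right hε'2 (norm_nonneg k)
      _ = (γ - lam) * (ε * ‖k‖) := by ring
  have h9 : ‖r‖ ≤ ε * ‖k‖ := le_of_mul_le_mul_left h8 hm
  simpa only [hr, hy] using h9

/-- **ASSEMBLED: THE FIBRE-CRITICAL MAP IS DIFFERENTIABLE AT EVERY POINT, DERIVATIVE = THE FIBRE RESPONSE** (same regime):
`∃ D`, `Qt (D k) = k`, the linearised covector on `D k` kills `ker Qt`, and `HasFDerivAt Φ D w`. [folklore] -/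
theorem exists_hasFDerivAt_fibreCritical (At : (ι → ℝ) →L[ℝ] (ι → ℝ))
    (hAt : ∀ φ ψ : ι → ℝ, ∑ x, ψ x * At φ x = ∑ x, φ x * At ψ x) {γ : ℝ}
    (hγ : ∀ h : ι → ℝ, γ * ∑ x, h x ^ 2 ≤ ∑ x, h x * At h x) {v u u' : ℝ → ℝ} (hv : ∀ t, HasDerivAt v (u t) t)
    (hu : ∀ t, HasDerivAt u (u' t) t) {lam : ℝ} (hu' : ∀ t, -lam ≤ u' t) (hγlam : lam < γ)
    (Qt : (ι → ℝ) →L[ℝ] (κ → ℝ)) (M : (κ → ℝ) →L[ℝ] (ι → ℝ)) (hM : ∀ k : κ → ℝ, Qt (M k) = k)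
    (Φ : (κ → ℝ) → (ι → ℝ)) (hΦQ : ∀ w, Qt (Φ w) = w)
    (hΦcrit : ∀ (w : κ → ℝ) (h : ι → ℝ), Qt h = 0 →
      fderiv ℝ (fun φ : ι → ℝ => (1 / 2 : ℝ) * ∑ x, φ x * At φ x + ∑ x, v (φ x)) (Φ w) h = 0)
    (w : κ → ℝ) :
    ∃ D : (κ → ℝ) →L[ℝ] (ι → ℝ), (∀ k : κ → ℝ, Qt (D k) = k) ∧
      (∀ (k : κ → ℝ) (κ' : ι → ℝ), Qt κ' = 0 → ∑ x, (At (D k) x + u' (Φ w x) * D k x) * κ' x = 0) ∧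
      HasFDerivAt Φ D w := by
  obtain ⟨H, hH⟩ := exists_clm_pairForm At (fun x => u' (Φ w x))
  have hfl : ∀ h : ι → ℝ, (γ - lam) * ∑ x, h x ^ 2 ≤ ∑ x, (At h x + u' (Φ w x) * h x) * h x := fun h =>
    response_form_floor At hγ (fun x => hu' (Φ w x)) h
  obtain ⟨D, hDQ, hDlin⟩ := exists_fibre_response At (sub_pos.2 hγlam) hfl Qt M hM hH
  have hDlin' : ∀ (k : κ → ℝ) (κ' : ι → ℝ), Qt κ' = 0 → ∑ x, (At (D k) x + u' (Φ w x) * D k x) * κ' x = 0 :=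
    fun k κ' hκ' => by rw [← hH]; exact hDlin k κ' hκ'
  exact ⟨D, hDQ, hDlin', hasFDerivAt_fibreCritical At hAt hγ hv hu hu' hγlam Qt M hM Φ hΦQ hΦcrit w hDQ hDlin'⟩

end Generic

/-! ## §2. The torus: the background map is continuous and differentiable at every block field -/

section Torus

variable (n : ℕ) (a : ℝ) (s : ℕ) [NeZero s]
  {Dop Aop : lp (fun _ : X d => ℝ) ∞ →L[ℝ] lp (fun _ : X d => ℝ) ∞}
  (hD : ∀ (f : lp (fun _ : X d => ℝ) ∞) (y : X d), Dop f y = (((n : ℝ) + 1) ^ d)⁻¹ * ∑ p ∈ B n y, f p)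
  (hA : ∀ (f : lp (fun _ : X d => ℝ) ∞) (p : X d), Aop f p = ∑ r ∈ nbhd n p, AX n a p r * f r)
  {v u u' : ℝ → ℝ} (hv : ∀ t, HasDerivAt v (u t) t) (hu : ∀ t, HasDerivAt u (u' t) t)
  {lam : ℝ} (hu' : ∀ t, -lam ≤ u' t) (hγ : lam < min 2 a)
  {Ef : (Site d ((n + 1) * s) → ℝ) →L[ℝ] lp (fun _ : X d => ℝ) ∞}
  (hEf : ∀ (g : Site d ((n + 1) * s) → ℝ) (q : X d), Ef g q = g (siteOf d ((n + 1) * s) q))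
  {Rf : lp (fun _ : X d => ℝ) ∞ →L[ℝ] (Site d ((n + 1) * s) → ℝ)}
  (hRf : ∀ (h : lp (fun _ : X d => ℝ) ∞) (x : Site d ((n + 1) * s)), Rf h x = h (windowMap d ((n + 1) * s) x))
  {Rc : lp (fun _ : X d => ℝ) ∞ →L[ℝ] (Site d s → ℝ)}
  (hRc : ∀ (h : lp (fun _ : X d => ℝ) ∞) (x : Site d s), Rc h x = h (windowMap d s x))

include hD hA hv hu hu' hγ hEf hRf hRc in
/-- **ANY TORUS BACKGROUND MAP IS CONTINUOUS** (`u′ ≥ −λ` on `ℝ`, `λ < min(2,a)`; `Φ` with block means `Q′t(Φ w) = w` and the sitewise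
equation at every `w` — exists uniquely by (93)). [folklore] -/
theorem torus_background_continuous (Φ : (Site d s → ℝ) → (Site d ((n + 1) * s) → ℝ))
    (hΦQ : ∀ w : Site d s → ℝ, ((Rc.comp Dop).comp Ef) (Φ w) = w)
    (hΦeq : ∀ (w : Site d s → ℝ) (p : X d), Aop (Ef (Φ w)) p + u (Ef (Φ w) p)
      = (((n : ℝ) + 1) ^ d)⁻¹ * ∑ p' ∈ B n (blk n p), (Aop (Ef (Φ w)) p' + u (Ef (Φ w) p'))) :
    Continuous Φ := by
  obtain ⟨M, -, hM⟩ := exists_clm_blockLift n s hD hEf hRc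
  exact continuous_iff_continuousAt.2 fun w =>
    continuousAt_fibreCritical ((Rf.comp Aop).comp Ef) (torus_operator_form_symm n a s hA hEf hRf)
      (torus_form_coercive n a s hA hEf hRf) hv hu hu' hγ ((Rc.comp Dop).comp Ef) M hM Φ hΦQ
      (fun w h hh => fderiv_action_torus_eq_zero n a s hD hA hEf hRf hRc hv (Φ w) (hΦeq w) h hh) w

include hD hA hv hu hu' hγ hEf hRf hRc in
/-- **ANY RESPONSE WITH THE TWO TORUS LETTERS IS THE DERIVATIVE OF THE BACKGROUND MAP**: block means `Q′t(Dt k) = k` and the linearised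
sitewise covector at `Φ wt` on `Dt k` killing the torus fibre ⟹ `HasFDerivAt Φ Dt wt`. [folklore] -/
theorem torus_background_hasFDerivAt_of_letters (Φ : (Site d s → ℝ) → (Site d ((n + 1) * s) → ℝ))
    (hΦQ : ∀ w : Site d s → ℝ, ((Rc.comp Dop).comp Ef) (Φ w) = w)
    (hΦeq : ∀ (w : Site d s → ℝ) (p : X d), Aop (Ef (Φ w)) p + u (Ef (Φ w) p)
      = (((n : ℝ) + 1) ^ d)⁻¹ * ∑ p' ∈ B n (blk n p), (Aop (Ef (Φ w)) p' + u (Ef (Φ w) p')))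
    (wt : Site d s → ℝ) {Dt : (Site d s → ℝ) →L[ℝ] (Site d ((n + 1) * s) → ℝ)}
    (hDQ : ∀ k : Site d s → ℝ, ((Rc.comp Dop).comp Ef) (Dt k) = k)
    (hDlin : ∀ (k : Site d s → ℝ) (κ' : Site d ((n + 1) * s) → ℝ), ((Rc.comp Dop).comp Ef) κ' = 0 →
      ∑ x, (((Rf.comp Aop).comp Ef) (Dt k) x + u' (Φ wt x) * Dt k x) * κ' x = 0) :
    HasFDerivAt Φ Dt wt := by
  obtain ⟨M, -, hM⟩ := exists_clm_blockLift n s hD hEf hRc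
  exact hasFDerivAt_fibreCritical ((Rf.comp Aop).comp Ef) (torus_operator_form_symm n a s hA hEf hRf)
    (torus_form_coercive n a s hA hEf hRf) hv hu hu' hγ ((Rc.comp Dop).comp Ef) M hM Φ hΦQ
    (fun w h hh => fderiv_action_torus_eq_zero n a s hD hA hEf hRf hRc hv (Φ w) (hΦeq w) h hh) wt hDQ hDlin

include hD hA hv hu hu' hγ hEf hRf hRc in
/-- **THE END: THE TORUS BACKGROUND MAP IS DIFFERENTIABLE AT EVERY BLOCK FIELD, DERIVATIVE = THE FIBRE RESPONSE.**  `v′ = u`, `u′` a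
derivative of `u` with `u′ ≥ −λ` on `ℝ`, `λ < min(2,a)`; `Φ` ANY background map (block means `Q′t(Φ w) = w` and the sitewise equation at
every `w` — it exists uniquely by (93)).  Then at EVERY coarse torus field `wt` there is a continuous linear `Dt` with
`Q′t(Dt k) = k`, `Σ_x ((At(Dt k)) x + u′(Φ wt x)·(Dt k) x)·κ x = 0` on the torus fibre (the linearised sitewise equation), and
`HasFDerivAt Φ Dt wt` — every mesh `n`, period `s`, dimension `d`; no smallness of `wt`; no chart. [folklore] -/
theorem torus_background_hasFDerivAt (Φ : (Site d s → ℝ) → (Site d ((n + 1) * s) → ℝ))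
    (hΦQ : ∀ w : Site d s → ℝ, ((Rc.comp Dop).comp Ef) (Φ w) = w)
    (hΦeq : ∀ (w : Site d s → ℝ) (p : X d), Aop (Ef (Φ w)) p + u (Ef (Φ w) p)
      = (((n : ℝ) + 1) ^ d)⁻¹ * ∑ p' ∈ B n (blk n p), (Aop (Ef (Φ w)) p' + u (Ef (Φ w) p')))
    (wt : Site d s → ℝ) :
    ∃ Dt : (Site d s → ℝ) →L[ℝ] (Site d ((n + 1) * s) → ℝ),
      (∀ k : Site d s → ℝ, ((Rc.comp Dop).comp Ef) (Dt k) = k) ∧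
      (∀ (k : Site d s → ℝ) (κ' : Site d ((n + 1) * s) → ℝ), ((Rc.comp Dop).comp Ef) κ' = 0 →
        ∑ x, (((Rf.comp Aop).comp Ef) (Dt k) x + u' (Φ wt x) * Dt k x) * κ' x = 0) ∧
      HasFDerivAt Φ Dt wt := by
  obtain ⟨M, -, hM⟩ := exists_clm_blockLift n s hD hEf hRc
  exact exists_hasFDerivAt_fibreCritical ((Rf.comp Aop).comp Ef) (torus_operator_form_symm n a s hA hEf hRf)
    (torus_form_coercive n a s hA hEf hRf) hv hu hu' hγ ((Rc.comp Dop).comp Ef) M hM Φ hΦQ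
    (fun w h hh => fderiv_action_torus_eq_zero n a s hD hA hEf hRf hRc hv (Φ w) (hΦeq w) h hh) wt

end Torus

/-! ## §3. Lattice `φ⁴`: the background map is differentiable everywhere when `g ≥ 0`, `−m < min(2,a)` -/

/-- **THE `φ⁴_d` TORUS BACKGROUND MAP IS DIFFERENTIABLE AT EVERY BLOCK FIELD** (`u t = g t³ + m t`, `0 ≤ g`, `−m < min(2,a)`; every
side `n + 1`, period `s ≥ 1`, dimension `d`; ANY operators ∕ carrier maps with the displayed actions; `Φ` ANY map with block means
`w` and the `φ⁴` sitewise equation at every `w` — it exists uniquely by (93) `existsUnique_phiFour_torus_background`): at every `wt`,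
`∃ Dt`, `Q′t(Dt k) = k`, `Σ_x ((At(Dt k)) x + (3g(Φ wt x)² + m)·(Dt k) x)·κ x = 0` on the fibre, `HasFDerivAt Φ Dt wt`. [folklore] -/
theorem phiFour_background_hasFDerivAt (n : ℕ) (a : ℝ) (s : ℕ) [NeZero s]
    {Dop Aop : lp (fun _ : X d => ℝ) ∞ →L[ℝ] lp (fun _ : X d => ℝ) ∞}
    (hD : ∀ (f : lp (fun _ : X d => ℝ) ∞) (y : X d), Dop f y = (((n : ℝ) + 1) ^ d)⁻¹ * ∑ p ∈ B n y, f p)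
    (hA : ∀ (f : lp (fun _ : X d => ℝ) ∞) (p : X d), Aop f p = ∑ r ∈ nbhd n p, AX n a p r * f r)
    {Ef : (Site d ((n + 1) * s) → ℝ) →L[ℝ] lp (fun _ : X d => ℝ) ∞}
    (hEf : ∀ (g : Site d ((n + 1) * s) → ℝ) (q : X d), Ef g q = g (siteOf d ((n + 1) * s) q))
    {Rf : lp (fun _ : X d => ℝ) ∞ →L[ℝ] (Site d ((n + 1) * s) → ℝ)}
    (hRf : ∀ (h : lp (fun _ : X d => ℝ) ∞) (x : Site d ((n + 1) * s)), Rf h x = h (windowMap d ((n + 1) * s) x))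
    {Rc : lp (fun _ : X d => ℝ) ∞ →L[ℝ] (Site d s → ℝ)}
    (hRc : ∀ (h : lp (fun _ : X d => ℝ) ∞) (x : Site d s), Rc h x = h (windowMap d s x))
    {g m : ℝ} (hg : 0 ≤ g) (hm : -m < min 2 a)
    (Φ : (Site d s → ℝ) → (Site d ((n + 1) * s) → ℝ))
    (hΦQ : ∀ w : Site d s → ℝ, ((Rc.comp Dop).comp Ef) (Φ w) = w)
    (hΦeq : ∀ (w : Site d s → ℝ) (p : X d), Aop (Ef (Φ w)) p + (g * (Ef (Φ w) p) ^ 3 + m * Ef (Φ w) p)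
      = (((n : ℝ) + 1) ^ d)⁻¹ * ∑ p' ∈ B n (blk n p), (Aop (Ef (Φ w)) p' + (g * (Ef (Φ w) p') ^ 3 + m * Ef (Φ w) p')))
    (wt : Site d s → ℝ) :
    ∃ Dt : (Site d s → ℝ) →L[ℝ] (Site d ((n + 1) * s) → ℝ),
      (∀ k : Site d s → ℝ, ((Rc.comp Dop).comp Ef) (Dt k) = k) ∧
      (∀ (k : Site d s → ℝ) (κ' : Site d ((n + 1) * s) → ℝ), ((Rc.comp Dop).comp Ef) κ' = 0 →
        ∑ x, (((Rf.comp Aop).comp Ef) (Dt k) x + (3 * g * (Φ wt x) ^ 2 + m) * Dt k x) * κ' x = 0) ∧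
      HasFDerivAt Φ Dt wt :=
  torus_background_hasFDerivAt n a s hD hA (v := fun t => g / 4 * t ^ 4 + m / 2 * t ^ 2)
    (u := fun t => g * t ^ 3 + m * t) (u' := fun t => 3 * g * t ^ 2 + m) (hasDerivAt_phiFour_potential g m)
    (hasDerivAt_phiFour g m) (lam := -m) (fun t => by nlinarith [sq_nonneg t]) (by simpa using hm) hEf hRf hRc Φ hΦQ hΦeq wt

end Summit.QuantumFields.BalabanUV.T4Continuum.NE7b.SupTorusBackgroundDerivative

end
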